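import Summits.CriticalPhenomena.CardyFormulaZ2.Theorems.CardyComplexConeEdgePrecompactUFRSCollarDecayRectLocality

/-!
# The junction-screened single-annulus bound for three strand-crossings at the boundary of a rectangle
(line `qkz-strip-boundary-arm` of crux `CardyComplexCone.EdgePrecompact`, stmt-CriticalPhenomena-11387;
third support file of the registered sub-goal `ufrs_screenedCollarDecay_rect`, M3 of the UFRS road map)

Input: the single-scale decay of three strand-crossings at a boundary point `p` (the registered
bridge `ufrs_rectBoundaryStrandDecay`, here as hypotheses at fixed data `E`, `w` and collar width
`η`, over an arbitrary set `S` of admissible centres): the ONE-ARM rate `C (a/b)^α` for every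
annulus `A(p; a, b)` with `a ≥ 8η`, and the THREE-ARM rate `C (a/b)^{1+α}` when no marked
(`A`–`B`) edge of `E` or of `shiftData E w` is within `2b` of `p` (`p ∉ ufrsMarkedNbhd E w (2b)`).

* `bridge_normalize` — reduction of the aspect-ratio threshold `K` to `2` and of the exponent to
  `α ≤ 1` (probabilities are `≤ 1`, and `C₁ (a/b)^θ ≥ 1` for `2a ≤ b < K a`, `θ ≤ 2`,
  `C₁ = max C 1 · (max K 2)²`);
* `real_ufrsStrands_le_split` (registered sub-goal) — **the junction-screened bound**: if the marked
  midpoints are at distance `≥ s ≥ 8a` from `p`, then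
  `P(three strands across A(p; a, b)) ≤ 16 C₁² (a / min s b) (a/b)^α`: for `b < s` shrink the
  annulus to `A(p; a, min b (s/4))` (three-arm rate); for `s ≤ b` SPLIT it into `A(p; a, s/4)`
  (three-arm rate) and `A(p; s/2, b)` (one-arm rate), independent by
  `real_inter_eq_of_ball_beyond` (`…UFRSCollarDecayRectLocality.lean`);
* `rpow_pair_le`, `rpow_out_le` — exponent bookkeeping for the two-scale products:
  `(32η/d)^α (24d/ρ)^α ≤ 768 (η/d)^{α/2} (d/ρ)^α` (`d ≥ 64η`) and
  `(24d/ρ)^α ≤ 1536 (η/d)^{α/2} (d/ρ)^α` (`4η ≤ d < 64η`); the slack `(ρ/d)^{α/2}` makes the sum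
  over dyadic `d` geometric.

References: G. F. Lawler, O. Schramm, W. Werner, Electron. J. Probab. 7 (2002), App. A (half-plane
arm exponents); H. Kesten, Comm. Math. Phys. 109 (1987) (multi-scale arm decompositions);
G. Grimmett, *Percolation* (1999), §2.2.
-/

namespace Summit.CriticalPhenomena.CardyFormulaZ2.Cruxes.EdgePrecompact.QkzStripBoundaryArm

open MeasureTheory Filter Set Metric
open scoped Topology BigOperators Pointwise
open Literature.Probability.LatticeModels Literature.Probability.Percolation
open Literature.Probability.RandomPlanarGeometry (DobrushinDomain)
open Summit.CriticalPhenomena.CardyFormulaZ2.Theses.CardyComplexCone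

noncomputable section


/-! ## Normalising the bridge -/

/-- **Normalisation of the single-scale bounds.** Bounds `C (r/R)^α` / `C (r/R)^{1+α}` valid for
`R ≥ K r` give bounds `C₁ (r/R)^{α₁}` / `C₁ (r/R)^{1+α₁}` valid for `R ≥ 2r`, with
`C₁ = max C 1 · (max K 2)²` and `α₁ = min α 1 ≤ 1` (for `2r ≤ R < K r` the probability is `≤ 1`
while `C₁ (r/R)^θ ≥ K² K^{-2}` for `θ ≤ 2`). -/
theorem bridge_normalize {S : Set ℂ} {C α K η : ℝ} (hα : 0 < α) (hK : 0 < K) (hη : 0 < η)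
    {E : DiscreteDobrushin} {w : Site 2}
    (hB : ∀ (z : ℂ) (r R : ℝ), z ∈ S → 8 * η ≤ r → K * r ≤ R →
      (bondPercolation (zdGraph 2) half).real (ufrsStrands E w z 3 r R) ≤ C * (r / R) ^ α ∧
      (z ∉ ufrsMarkedNbhd E w (2 * R) →
        (bondPercolation (zdGraph 2) half).real (ufrsStrands E w z 3 r R) ≤ C * (r / R) ^ (1 + α))) :
    (∀ (z : ℂ) (r R : ℝ), z ∈ S → 8 * η ≤ r → 2 * r ≤ R →
      (bondPercolation (zdGraph 2) half).real (ufrsStrands E w z 3 r R) ≤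
        (max C 1 * (max K 2) ^ 2) * (r / R) ^ min α 1) ∧
    (∀ (z : ℂ) (r R : ℝ), z ∈ S → 8 * η ≤ r → 2 * r ≤ R → z ∉ ufrsMarkedNbhd E w (2 * R) →
      (bondPercolation (zdGraph 2) half).real (ufrsStrands E w z 3 r R) ≤
        (max C 1 * (max K 2) ^ 2) * (r / R) ^ (1 + min α 1)) := by
  set μ := bondPercolation (zdGraph 2) half with hμ
  have hC₁ : max C 1 ≤ max C 1 * (max K 2) ^ 2 := by
    have : (1 : ℝ) ≤ (max K 2) ^ 2 := by nlinarith [le_max_right K 2]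
    nlinarith [le_max_right C 1]
  have hCC₁ : C ≤ max C 1 * (max K 2) ^ 2 := (le_max_left C 1).trans hC₁
  -- the common core: for every admissible exponent `θ ≤ 2` either the bridge applies or `P ≤ 1 ≤ bound`
  have key : ∀ (z : ℂ) (r R θ : ℝ), z ∈ S → 8 * η ≤ r → 2 * r ≤ R → 0 ≤ θ → θ ≤ 2 →
      (K * r ≤ R → ∃ θ', θ ≤ θ' ∧ μ.real (ufrsStrands E w z 3 r R) ≤ C * (r / R) ^ θ') →
      μ.real (ufrsStrands E w z 3 r R) ≤ (max C 1 * (max K 2) ^ 2) * (r / R) ^ θ := by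
    intro z r R θ hz hr hR hθ0 hθ2 hbr
    have hr0 : 0 < r := by linarith
    have hR0 : 0 < R := by linarith
    have hx0 : 0 < r / R := div_pos hr0 hR0
    have hx1 : r / R ≤ 1 := by rw [div_le_one hR0]; linarith
    by_cases hKR : K * r ≤ R
    · obtain ⟨θ', hθθ', hP⟩ := hbr hKR
      have hC0 : 0 ≤ C := by
        by_contra hC0
        rw [not_le] at hC0
        have : μ.real (ufrsStrands E w z 3 r R) < 0 :=
          hP.trans_lt (mul_neg_of_neg_of_pos hC0 (Real.rpow_pos_of_pos hx0 _))
        exact absurd this (not_lt.2 measureReal_nonneg)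
      calc μ.real (ufrsStrands E w z 3 r R) ≤ C * (r / R) ^ θ' := hP
        _ ≤ (max C 1 * (max K 2) ^ 2) * (r / R) ^ θ :=
          mul_le_mul hCC₁ (Real.rpow_le_rpow_of_exponent_ge hx0 hx1 hθθ') (Real.rpow_nonneg hx0.le _)
            (by positivity)
    · -- `2 r ≤ R < K r`: the probability is at most one
      rw [not_le] at hKR
      have hK2 : max K 2 = K := max_eq_left (by nlinarith)
      have h1 : 1 ≤ K * (r / R) := by
        rw [mul_div_assoc', le_div_iff₀ hR0]; linarith
      have h2 : (r / R) ^ (2 : ℝ) ≤ (r / R) ^ θ := Real.rpow_le_rpow_of_exponent_ge hx0 hx1 hθ2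
      rw [Real.rpow_two] at h2
      calc μ.real (ufrsStrands E w z 3 r R) ≤ 1 := measureReal_le_one
        _ ≤ (K * (r / R)) ^ 2 := by nlinarith
        _ = (1 * K ^ 2) * (r / R) ^ 2 := by ring
        _ ≤ (max C 1 * (max K 2) ^ 2) * (r / R) ^ θ := by
          rw [hK2]
          exact mul_le_mul (by nlinarith [le_max_right C 1]) h2 (by positivity) (by positivity)
  refine ⟨fun z r R hz hr hR => key z r R _ hz hr hR (le_min hα.le zero_le_one)
      ((min_le_right α 1).trans one_le_two) fun hKR => ⟨α, min_le_left α 1, (hB z r R hz hr hKR).1⟩,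
    fun z r R hz hr hR hfree => key z r R _ hz hr hR (by positivity) (by linarith [min_le_right α 1])
      fun hKR => ⟨1 + α, by linarith [min_le_left α 1], (hB z r R hz hr hKR).2 hfree⟩⟩

/-! ## The junction-screened single-annulus bound -/

/-- **The junction-screened bound for one annulus.** Under the normalised one-arm / three-arm bounds
at collar width `η` (ratio `≥ 2`, exponent `α ≤ 1`, constant `C₁ ≥ 1`), at a point `p` whose
marked midpoints are at distance `≥ s` in the sense `2b' < s → p ∉ ufrsMarkedNbhd E w (2b')`, for
`8η ≤ a`, `2a ≤ b`, `8a ≤ s`: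
`P(ufrsStrands E w p 3 a b) ≤ 16 C₁² (a / min s b) (a/b)^α` — shrink the outer radius to
`min b (s/4)` if `b < s` (three-arm rate), else split the annulus at the junction scale into
`A(p; a, s/4)` (three-arm rate) and `A(p; s/2, b)` (one-arm rate), which are independent. -/
theorem real_ufrsStrands_le_split : ∀ (S : Set ℂ) (C₁ α η : ℝ) (E : DiscreteDobrushin) (w : Site 2) (p : ℂ) (s a b : ℝ), 1 ≤ C₁ → 0 < α → α ≤ 1 → 0 < η → 0 < E.δ → E.δ ≤ η → (∀ (z : ℂ) (r R : ℝ), z ∈ S → 8 * η ≤ r → 2 * r ≤ R → (bondPercolation (zdGraph 2) half).real (ufrsStrands E w z 3 r R) ≤ C₁ * (r / R) ^ α) → (∀ (z : ℂ) (r R : ℝ), z ∈ S → 8 * η ≤ r → 2 * r ≤ R → z ∉ ufrsMarkedNbhd E w (2 * R) → (bondPercolation (zdGraph 2) half).real (ufrsStrands E w z 3 r R) ≤ C₁ * (r / R) ^ (1 + α)) → p ∈ S → (∀ b' : ℝ, 2 * b' < s → p ∉ ufrsMarkedNbhd E w (2 * b')) → 8 * η ≤ a → 2 * a ≤ b → 8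 * a ≤ s → (bondPercolation (zdGraph 2) half).real (ufrsStrands E w p 3 a b) ≤ 16 * C₁ ^ 2 * (a / min s b) * (a / b) ^ α := by
  intro S C₁ α η E w p s a b hC₁ hα hα1 hη hδ hδη hO hF hp hs ha hab has
  set μ := bondPercolation (zdGraph 2) half with hμ
  have ha0 : 0 < a := by linarith
  have hb0 : 0 < b := by linarith
  have hs0 : 0 < s := by linarith
  have hab0 : 0 < a / b := div_pos ha0 hb0
  have hC₁2 : C₁ ≤ C₁ ^ 2 := by nlinarith
  by_cases hbs : b < s
  · -- shrink the outer radius below the junction scale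
    set b' := min b (s / 4) with hb'
    have hb'0 : 0 < b' := lt_min hb0 (by linarith)
    have hb'b : b' ≤ b := min_le_left _ _
    have h2ab' : 2 * a ≤ b' := le_min hab (by linarith)
    have hbb' : b ≤ 4 * b' := by
      rcases le_total b (s / 4) with h | h
      · rw [hb', min_eq_left h]; linarith
      · rw [hb', min_eq_right h]; linarith
    have hfree : p ∉ ufrsMarkedNbhd E w (2 * b') := hs b' (by linarith [min_le_right b (s / 4)])
    have hmono : ufrsStrands E w p 3 a b ⊆ ufrsStrands E w p 3 a b' := ufrsStrands_mono_radii le_rfl hb'b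
    have hx0 : 0 < a / b' := div_pos ha0 hb'0
    have hx4 : a / b' ≤ 4 * (a / b) := by
      rw [div_le_iff₀ hb'0, show 4 * (a / b) * b' = a * (4 * b') / b by ring, le_div_iff₀ hb0]
      nlinarith
    have hmin : min s b = b := min_eq_right hbs.le
    calc μ.real (ufrsStrands E w p 3 a b) ≤ μ.real (ufrsStrands E w p 3 a b') :=
          measureReal_mono hmono (measure_ne_top _ _)
      _ ≤ C₁ * (a / b') ^ (1 + α) := hF p a b' hp ha h2ab' hfree
      _ = C₁ * (a / b') * (a / b') ^ α := by rw [Real.rpow_add hx0, Real.rpow_one, mul_assoc]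
      _ ≤ C₁ * (4 * (a / b)) * (4 * (a / b)) ^ α := by
          gcongr
      _ = 16 * C₁ * (a / b) * ((4:ℝ) ^ α / 4 * (a / b) ^ α) := by
          rw [Real.mul_rpow (by norm_num) hab0.le]; ring
      _ ≤ 16 * C₁ ^ 2 * (a / min s b) * (1 * (a / b) ^ α) := by
          rw [hmin]
          gcongr
          have : (4:ℝ) ^ α ≤ 4 := Real.rpow_le_self_of_one_le (by norm_num) hα1
          linarith
      _ = 16 * C₁ ^ 2 * (a / min s b) * (a / b) ^ α := by ring
  · -- split the annulus at the junction scale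
    rw [not_lt] at hbs
    have hmin : min s b = s := min_eq_left hbs
    have h4as : a < s / 4 := by linarith
    have hs2b : s / 2 < b := by linarith
    have hmono : ufrsStrands E w p 3 a b ⊆ ufrsStrands E w p 3 a (s / 4) ∩ ufrsStrands E w p 3 (s / 2) b :=
      Set.subset_inter (ufrsStrands_mono_radii le_rfl (by linarith)) (ufrsStrands_mono_radii (by linarith) le_rfl)
    have hind : μ.real (ufrsStrands E w p 3 a (s / 4) ∩ ufrsStrands E w p 3 (s / 2) b) =
        μ.real (ufrsStrands E w p 3 a (s / 4)) * μ.real (ufrsStrands E w p 3 (s / 2) b) :=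
      real_inter_eq_of_ball_beyond (R₁ := s / 4 + 2 * E.δ) (r₂ := s / 2 - 2 * E.δ) (by linarith)
        (determinedBy_ufrsStrands_ball hδ w p 3 h4as) (determinedBy_ufrsStrands_beyond hδ w p 3 hs2b)
        (measurableSet_ufrsStrands hδ w p 3 h4as) (measurableSet_ufrsStrands hδ w p 3 hs2b)
    have hin : μ.real (ufrsStrands E w p 3 a (s / 4)) ≤ C₁ * (a / (s / 4)) ^ (1 + α) :=
      hF p a (s / 4) hp ha (by linarith) (hs (s / 4) (by linarith))
    have hout : μ.real (ufrsStrands E w p 3 (s / 2) b) ≤ C₁ * (s / 2 / b) ^ α :=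
      hO p (s / 2) b hp (by linarith) (by linarith)
    have hx0 : 0 < a / (s / 4) := by positivity
    have hy0 : 0 < s / 2 / b := by positivity
    have hxy : a / (s / 4) * (s / 2 / b) = 2 * (a / b) := by field_simp; ring
    calc μ.real (ufrsStrands E w p 3 a b)
        ≤ μ.real (ufrsStrands E w p 3 a (s / 4) ∩ ufrsStrands E w p 3 (s / 2) b) :=
          measureReal_mono hmono (measure_ne_top _ _)
      _ = μ.real (ufrsStrands E w p 3 a (s / 4)) * μ.real (ufrsStrands E w p 3 (s / 2) b) := hind
      _ ≤ (C₁ * (a / (s / 4)) ^ (1 + α)) * (C₁ * (s / 2 / b) ^ α) :=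
          mul_le_mul hin hout measureReal_nonneg (by positivity)
      _ = C₁ ^ 2 * (a / (s / 4)) * ((a / (s / 4)) ^ α * (s / 2 / b) ^ α) := by
          rw [Real.rpow_add hx0, Real.rpow_one]; ring
      _ = C₁ ^ 2 * (4 * (a / s)) * ((2:ℝ) ^ α * (a / b) ^ α) := by
          rw [← Real.mul_rpow hx0.le hy0.le, hxy, Real.mul_rpow (by norm_num) hab0.le]
          congr 2
          field_simp
      _ ≤ C₁ ^ 2 * (4 * (a / s)) * (2 * (a / b) ^ α) := by
          gcongr
          exact Real.rpow_le_self_of_one_le (by norm_num) hα1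
      _ ≤ 16 * C₁ ^ 2 * (a / min s b) * (a / b) ^ α := by
          rw [hmin]
          have : 0 ≤ C₁ ^ 2 * (a / s) * (a / b) ^ α := by positivity
          nlinarith


/-! ## Exponent bookkeeping for the two-scale products -/

/-- Exponent bookkeeping, inner annulus present (`d ≥ 64η`):
`(32η/d)^α (24d/ρ)^α ≤ 768 (η/d)^{α/2} (d/ρ)^α`. -/
theorem rpow_pair_le {η d ρ α : ℝ} (hη : 0 < η) (hd : 64 * η ≤ d) (hdρ : 64 * d ≤ ρ) (hα : 0 < α)
    (hα1 : α ≤ 1) :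
    (8 * η / (d / 4)) ^ α * (3 * d / (ρ / 8)) ^ α ≤ 768 * ((η / d) ^ (α / 2) * (d / ρ) ^ α) := by
  have hd0 : 0 < d := by linarith
  have hρ0 : 0 < ρ := by linarith
  have hu0 : 0 ≤ η / d := by positivity
  have hu1 : η / d ≤ 1 := by rw [div_le_one hd0]; linarith
  have hv0 : 0 ≤ d / ρ := by positivity
  rw [show 8 * η / (d / 4) = 32 * (η / d) by field_simp; ring,
    show 3 * d / (ρ / 8) = 24 * (d / ρ) by field_simp; ring,
    Real.mul_rpow (by norm_num) hu0, Real.mul_rpow (by norm_num) hv0]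
  have h32 : (32:ℝ) ^ α ≤ 32 := Real.rpow_le_self_of_one_le (by norm_num) hα1
  have h24 : (24:ℝ) ^ α ≤ 24 := Real.rpow_le_self_of_one_le (by norm_num) hα1
  have hu : (η / d) ^ α ≤ (η / d) ^ (α / 2) :=
    Real.rpow_le_rpow_of_exponent_ge' hu0 hu1 (by positivity) (by linarith)
  have h1 : (32:ℝ) ^ α * (η / d) ^ α ≤ 32 * (η / d) ^ (α / 2) :=
    mul_le_mul h32 hu (by positivity) (by norm_num)
  have h2 : (24:ℝ) ^ α * (d / ρ) ^ α ≤ 24 * (d / ρ) ^ α :=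
    mul_le_mul_of_nonneg_right h24 (by positivity)
  calc (32:ℝ) ^ α * (η / d) ^ α * ((24:ℝ) ^ α * (d / ρ) ^ α)
      ≤ (32 * (η / d) ^ (α / 2)) * (24 * (d / ρ) ^ α) := mul_le_mul h1 h2 (by positivity) (by positivity)
    _ = 768 * ((η / d) ^ (α / 2) * (d / ρ) ^ α) := by ring

/-- Exponent bookkeeping, inner annulus absent (`4η ≤ d < 64η`):
`(24d/ρ)^α ≤ 1536 (η/d)^{α/2} (d/ρ)^α` (as `64 (η/d)^{α/2} ≥ 1`). -/
theorem rpow_out_le {η d ρ α : ℝ} (hη : 0 < η) (hd : 4 * η ≤ d) (hd' : d < 64 * η) (hα : 0 < α)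
    (hα1 : α ≤ 1) (hρ : 0 < ρ) :
    (3 * d / (ρ / 8)) ^ α ≤ 1536 * ((η / d) ^ (α / 2) * (d / ρ) ^ α) := by
  have hd0 : 0 < d := by linarith
  have hu0 : 0 < η / d := by positivity
  have hv0 : 0 ≤ d / ρ := by positivity
  rw [show 3 * d / (ρ / 8) = 24 * (d / ρ) by field_simp; ring, Real.mul_rpow (by norm_num) hv0]
  have h24 : (24:ℝ) ^ α ≤ 24 := Real.rpow_le_self_of_one_le (by norm_num) hα1
  have hu64 : 1 / 64 < η / d := by
    rw [div_lt_div_iff₀ (by norm_num) hd0]; linarith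
  have hlow : 1 ≤ 64 * (η / d) ^ (α / 2) := by
    rcases le_or_gt 1 (η / d) with h | h
    · have : 1 ≤ (η / d) ^ (α / 2) := Real.one_le_rpow h (by positivity)
      linarith
    · have : (η / d) ^ (1:ℝ) ≤ (η / d) ^ (α / 2) :=
        Real.rpow_le_rpow_of_exponent_ge hu0 h.le (by linarith)
      rw [Real.rpow_one] at this
      linarith
  have h2 : (24:ℝ) ^ α * (d / ρ) ^ α ≤ 24 * (d / ρ) ^ α := mul_le_mul_of_nonneg_right h24 (by positivity)
  have h3 : 0 ≤ (d / ρ) ^ α := by positivity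
  calc (24:ℝ) ^ α * (d / ρ) ^ α ≤ 24 * (d / ρ) ^ α * 1 := by linarith
    _ ≤ 24 * (d / ρ) ^ α * (64 * (η / d) ^ (α / 2)) := mul_le_mul_of_nonneg_left hlow (by positivity)
    _ = 1536 * ((η / d) ^ (α / 2) * (d / ρ) ^ α) := by ring

end

end Summit.CriticalPhenomena.CardyFormulaZ2.Cruxes.EdgePrecompact.QkzStripBoundaryArm
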